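import Mathlib
import Summits.NavierStokesRegularity.NavierStokesRegularity.Theorems.EulerZoomLiouvillePowerGaugeEulerLiouvilleNeedleCauchyLocal
import Summits.NavierStokesRegularity.NavierStokesRegularity.Theorems.EulerZoomLiouvillePowerGaugeEulerLiouvilleSelfSimilarBernoulliSqueezeFreeCrossing
import Literature.Analysis.FluidPDE.TaoEnstrophyLocalisation
import HarnessLib.Audit

/-!
# Crux E `EulerZoomLiouville.PowerGaugeEulerLiouville` — THE LABEL-AVERAGED ENSTROPHY LAW for lingering sets
# (tool for ROUND-40/41's label census, nsreg-p2 g33 §3 «Liouville e^{3γσ} kills label averages»)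

Route №10 `EulerZoomLiouville` (NavierStokesRegularity), crux E = stmt-NavierStokesRegularity-19832, registered residue
`stub_selfSimilarC2Needle`; seat ns-ezl-w5 g3, `--supports stmt-NavierStokesRegularity-19832 --as helper`.  The core of this
seat's Liouville–Chebyshev race (`NeedleClock.volume_linger_set_le_of_stretching`, …NeedleStrainClockEnstrophy p648172) with the
stretching hypothesis REMOVED, so that ANY pointwise vorticity-growth law along lingering orbits (constant rate t40d (S3),
variable rate t40h (T1), compression t40f, hovering …) can be integrated against it:

* `NeedleClock.lintegral_curl_sq_closedBall_le` — the E-gauge dictionary for vorticity: `∫⁻_{B̄_M}‖curl V‖² ≤ ‖curlCLM‖²·C_E·M^{1−ρ}`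
  from `∫⁻_{B̄_M}‖DV‖² ≤ C_E M^{1−ρ}` (`‖curl V‖ ≤ ‖curlCLM‖‖DV‖`, `Literature.Analysis.FluidPDE.norm_curl_le`);
* `NeedleClock.flow_preimage_subset_closedBall_of_linger` — the time-`t` image `Ψ_t(D) = Φ_t⁻¹(D)` of a set of labels lingering
  in `‖·‖ ≤ M` during `[0,t]` lies in `B̄_M`;
* **`NeedleClock.lintegral_curl_flow_sq_le_of_linger`** — THE LABEL-AVERAGED ENSTROPHY LAW: for a classical self-similar Euler
  profile `(V, P′)` at rate `1/(2+ρ)`, a `C²` cut-off copy `V′` (`‖DV′‖ ≤ K`, `V′ = V` on `ball 0 R_big ⊋ B̄_M`, `M ≥ 1`) and a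
  measurable set `D` of labels lingering in `‖·‖ ≤ M` during `[0, t]` (`t ≥ 0`):
  `∫⁻_{y ∈ D} ‖curl V (Ψ_t y)‖² dy ≤ e^{3t/(2+ρ)} · ‖curlCLM‖² · C_E · M^{1−ρ}`
  (local Liouville law in change-of-variables form, `Loc.lintegral_comp_backwardFlow_eq_of_stay`, ezl-w5 g2 p643827).
  Reading: whatever makes `‖Ω(Ψ_t y)‖` large along MANY lingering labels must pay from the budget `e^{3γt} R^{1−ρ}`; with
  `‖Ω(Ψ_t y)‖ ≥ ω e^{∫₀ᵗ(1−λ)}` (t40h) this is Jensen-ready: the label-averaged total stretching deficit on `D` is at most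
  `(3γt + log(‖curlCLM‖² C_E M^{1−ρ} / (ω² vol D)))/2`.

NOT NS, not E: Lagrangian bookkeeping for HYPOTHETICAL self-similar Euler profiles (MODEL lattice, crux CLASS); 19832 OPEN.
References: Constantin–Ignatova–Vicol arXiv:2602.17570 §3.4.1 (3.22)–(3.24) [ConstantinIgnatovaVicol2026Putative]; Liouville's
formula [folklore].
-/

noncomputable section

-- the summit and its single problem share the name `NavierStokesRegularity` (D-0017 nested layout)
set_option linter.dupNamespace false

open Set Filter Topology Metric Function MeasureTheory InnerProductSpace
open scoped RealInnerProductSpace NNReal ENNReal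

namespace Summit.NavierStokesRegularity.NavierStokesRegularity.Theorems.PowerGaugeEulerLiouville.NeedleClock

open Literature.Analysis Literature.Analysis.FluidPDE
open Summit.NavierStokesRegularity.NavierStokesRegularity.Theorems.PowerGaugeEulerLiouville

variable {ρ γ : ℝ} {V V' : EuclideanSpace ℝ (Fin 3) → EuclideanSpace ℝ (Fin 3)} {P' : EuclideanSpace ℝ (Fin 3) → ℝ}

/-- **The E-gauge dictionary for vorticity**: `∫⁻_{B̄_M}‖curl V‖² ≤ ‖curlCLM‖² · C_E · M^{1−ρ}` whenever
`∫⁻_{B̄_M}‖DV‖² ≤ C_E M^{1−ρ}`. [folklore] -/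
theorem lintegral_curl_sq_closedBall_le {CE M : ℝ}
    (hbE : ∫⁻ z in closedBall (0 : EuclideanSpace ℝ (Fin 3)) M, ‖fderiv ℝ V z‖ₑ ^ 2 ≤
      ENNReal.ofReal (CE * M ^ (1 - ρ))) :
    ∫⁻ z in closedBall (0 : EuclideanSpace ℝ (Fin 3)) M, ‖curl V z‖ₑ ^ 2 ≤
      ENNReal.ofReal (‖(curlCLM : (EuclideanSpace ℝ (Fin 3) →L[ℝ] EuclideanSpace ℝ (Fin 3)) →L[ℝ]
        EuclideanSpace ℝ (Fin 3))‖ ^ 2 * (CE * M ^ (1 - ρ))) := by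
  set cC : ℝ := ‖(curlCLM : (EuclideanSpace ℝ (Fin 3) →L[ℝ] EuclideanSpace ℝ (Fin 3)) →L[ℝ]
    EuclideanSpace ℝ (Fin 3))‖ with hcC
  calc ∫⁻ z in closedBall (0 : EuclideanSpace ℝ (Fin 3)) M, ‖curl V z‖ₑ ^ 2
      ≤ ∫⁻ z in closedBall (0 : EuclideanSpace ℝ (Fin 3)) M, ENNReal.ofReal (cC ^ 2) * ‖fderiv ℝ V z‖ₑ ^ 2 := by
        refine lintegral_mono fun z => ?_
        rw [← ofReal_norm, ← ofReal_norm, ← ENNReal.ofReal_pow (norm_nonneg _),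
          ← ENNReal.ofReal_pow (norm_nonneg _), ← ENNReal.ofReal_mul (sq_nonneg _), ← mul_pow]
        exact ENNReal.ofReal_le_ofReal (pow_le_pow_left₀ (norm_nonneg _) (norm_curl_le V z) 2)
    _ = ENNReal.ofReal (cC ^ 2) * ∫⁻ z in closedBall (0 : EuclideanSpace ℝ (Fin 3)) M, ‖fderiv ℝ V z‖ₑ ^ 2 :=
        lintegral_const_mul' _ _ ENNReal.ofReal_ne_top
    _ ≤ ENNReal.ofReal (cC ^ 2) * ENNReal.ofReal (CE * M ^ (1 - ρ)) := by gcongr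
    _ = ENNReal.ofReal (cC ^ 2 * (CE * M ^ (1 - ρ))) := (ENNReal.ofReal_mul (sq_nonneg _)).symm

/-- **The time-`t` image of a lingering set lies in the ball**: if every label of `D` stays in `‖·‖ ≤ M` during `[0, t]`
(`t ≥ 0`) under the backward cut-off similarity flow `Ψ_σ = Φ_{−σ}` (`V′ ∈ C¹`, `‖DV′‖ ≤ K`), then `Φ_t⁻¹(D) = Ψ_t(D) ⊆ B̄_M`.
[folklore] -/
theorem flow_preimage_subset_closedBall_of_linger (hV' : ContDiff ℝ 1 V') {K : ℝ} (hK : ∀ y, ‖fderiv ℝ V' y‖ ≤ K)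
    {M t : ℝ} (ht : 0 ≤ t) {D : Set (EuclideanSpace ℝ (Fin 3))}
    (hstay : ∀ y ∈ D, ∀ σ ∈ Icc 0 t,
      ‖ODE.evolutionMap (fun _ : ℝ => selfSimilarTransport γ 0 V') 0 (-σ) y‖ ≤ M) :
    ODE.evolutionMap (fun _ : ℝ => selfSimilarTransport γ 0 V') 0 t ⁻¹' D ⊆
      closedBall (0 : EuclideanSpace ℝ (Fin 3)) M := by
  intro z hz
  have hback : ODE.evolutionMap (fun _ : ℝ => selfSimilarTransport γ 0 V') 0 (-t)
      (ODE.evolutionMap (fun _ : ℝ => selfSimilarTransport γ 0 V') 0 t z) = z := by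
    have h1 := C2.Kelvin.flow_add (γ := γ) hV' hK (-t) t z
    rw [neg_add_cancel] at h1
    rw [← h1]; exact ODE.evolutionMap_self _ 0 z
  have h := hstay _ hz t (right_mem_Icc.2 ht)
  rw [hback] at h
  exact mem_closedBall_zero_iff.2 h

/-- **THE LABEL-AVERAGED ENSTROPHY LAW for lingering sets.**  `(V, P′)` a classical self-similar Euler profile at rate
`1/(2+ρ)` with `∫⁻_{B̄_L}‖DV‖² ≤ C_E L^{1−ρ}` (`L ≥ 1`); `V′` a `C²` cut-off copy (`‖DV′‖ ≤ K`, `V′ = V` on `ball 0 R_big`,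
`1 ≤ M < R_big`); `D` a measurable set of labels lingering in `‖·‖ ≤ M` during `[0, t]` (`t ≥ 0`).  Then
`∫⁻_{y ∈ D} ‖curl V (Ψ_t y)‖² ≤ e^{3t/(2+ρ)} · ‖curlCLM‖² · C_E · M^{1−ρ}`.
[cite: ConstantinIgnatovaVicol2026Putative, §3.4.1 eq. (3.22)] -/
theorem lintegral_curl_flow_sq_le_of_linger (hprof : IsSelfSimilarEulerProfile (1 / (2 + ρ)) 0 V P') {CE : ℝ}
    (hbE : ∀ L : ℝ, 1 ≤ L → ∫⁻ z in closedBall (0 : EuclideanSpace ℝ (Fin 3)) L, ‖fderiv ℝ V z‖ₑ ^ 2 ≤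
      ENNReal.ofReal (CE * L ^ (1 - ρ)))
    (hV' : ContDiff ℝ 2 V') {K : ℝ} (hK : ∀ y, ‖fderiv ℝ V' y‖ ≤ K) {M Rbig : ℝ} (hM1 : 1 ≤ M) (hMR : M < Rbig)
    (hVU : ∀ w ∈ ball (0 : EuclideanSpace ℝ (Fin 3)) Rbig, V' w = V w)
    {D : Set (EuclideanSpace ℝ (Fin 3))} (hDm : MeasurableSet D) {t : ℝ} (ht : 0 ≤ t)
    (hstay : ∀ y ∈ D, ∀ σ ∈ Icc 0 t,
      ‖ODE.evolutionMap (fun _ : ℝ => selfSimilarTransport (1 / (2 + ρ)) 0 V') 0 (-σ) y‖ ≤ M) :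
    ∫⁻ y in D, ‖curl V (ODE.evolutionMap (fun _ : ℝ => selfSimilarTransport (1 / (2 + ρ)) 0 V') 0 (-t) y)‖ₑ ^ 2 ≤
      ENNReal.ofReal (Real.exp (3 * (1 / (2 + ρ)) * t) *
        (‖(curlCLM : (EuclideanSpace ℝ (Fin 3) →L[ℝ] EuclideanSpace ℝ (Fin 3)) →L[ℝ] EuclideanSpace ℝ (Fin 3))‖ ^ 2 *
          (CE * M ^ (1 - ρ)))) := by
  set γ : ℝ := 1 / (2 + ρ) with hγ
  set Φ := ODE.evolutionMap (fun _ : ℝ => selfSimilarTransport γ 0 V') 0 with hΦ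
  have hV'1 : ContDiff ℝ 1 V' := hV'.of_le (by norm_num)
  -- the cut-off is divergence free on `B̄_M`
  have hdiv : ∀ z : EuclideanSpace ℝ (Fin 3), ‖z‖ ≤ M → VectorCalculus.divergence V' z = 0 := by
    intro z hz
    have hzb : z ∈ ball (0 : EuclideanSpace ℝ (Fin 3)) Rbig := mem_ball_zero_iff.2 (lt_of_le_of_lt hz hMR)
    have hfd : fderiv ℝ V' z = fderiv ℝ V z := fderiv_eq_of_agree_ball hVU hzb
    have h := hprof.divFree z
    simp only [VectorCalculus.divergence] at h ⊢
    rw [hfd]; exact h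
  -- Liouville change of variables, image in the ball, enstrophy budget
  have hcov := Loc.lintegral_comp_backwardFlow_eq_of_stay (γ := γ) hV' hK ht hdiv hDm hstay
    (fun z => ‖curl V z‖ₑ ^ 2)
  have hsub : Φ t ⁻¹' D ⊆ closedBall (0 : EuclideanSpace ℝ (Fin 3)) M :=
    flow_preimage_subset_closedBall_of_linger (γ := γ) hV'1 hK ht hstay
  calc ∫⁻ y in D, ‖curl V (Φ (-t) y)‖ₑ ^ 2
      = ENNReal.ofReal (Real.exp (3 * γ * t)) * ∫⁻ z in Φ t ⁻¹' D, ‖curl V z‖ₑ ^ 2 := hcov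
    _ ≤ ENNReal.ofReal (Real.exp (3 * γ * t)) * ∫⁻ z in closedBall (0 : EuclideanSpace ℝ (Fin 3)) M, ‖curl V z‖ₑ ^ 2 := by
        gcongr
    _ ≤ ENNReal.ofReal (Real.exp (3 * γ * t)) * ENNReal.ofReal (‖(curlCLM : (EuclideanSpace ℝ (Fin 3) →L[ℝ]
          EuclideanSpace ℝ (Fin 3)) →L[ℝ] EuclideanSpace ℝ (Fin 3))‖ ^ 2 * (CE * M ^ (1 - ρ))) := by
        gcongr
        exact lintegral_curl_sq_closedBall_le (hbE M hM1)
    _ = _ := (ENNReal.ofReal_mul (Real.exp_pos _).le).symm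

end Summit.NavierStokesRegularity.NavierStokesRegularity.Theorems.PowerGaugeEulerLiouville.NeedleClock

end
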